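import Summits.SmoothPoincare4.SmoothPoincare4.Theorems.ConvexBisectionAcyclicBisectionExistsHurwitzMoveTransfer
import HarnessLib

/-!
# One signed Hurwitz move: the transfer form from the CORRECTED adjacent swap (N1 assembly, II)
(wave 6, brick of stub `stub_M2geo` = node N1 of NF4, line `modp-braid-orbits`, crux
`ConvexBisection.AcyclicBisectionExists`, item stmt-SmoothPoincare4-10508; registered sub-goal
`helper_getElem_off_positions`)

`…HurwitzMoveTransfer.lean` (p165490) proved (M2-T) from a swap node whose output keeps the
untouched attaching maps LITERALLY (`h' k = h k` off `{i, i+1}`).  That hypothesis is too strong to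
be provable in general: the tube `range (h k).toFun` of a THIRD handle is an arbitrary open set
(an embedded copy of Kosinski's `T`, with fingers) and may fill the target page of a moved handle up
to a graph, so no new attaching circle of the prescribed (non-peripheral) class can avoid it and no
`MultiAttachmentData` of the literal family exists.  The honest swap SHRINKS all tubes (locality of
attachments, `IsMultiAttachment.of_eqOn_near_sphere`) and reports the untouched handles by their
pages, shadows and twistings.  This file re-proves the transfer with that corrected hypothesis
(`transfer_of_swap'`; same proof: unpack `HurwitzStep`, swap with `up :=` the disjunct, V4's
`belt_pos`, re-index along `finCongr ≫ Equiv.swap` with V5's `reindexData`, letters of `l'`), and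
derives (HS) (`hs_of_swap'`, via `hurwitzStep_of_redecomposition`, p134969) and the registered N1
text (`m2geo_of_swap'`, via `m2geo_of_transfer`).  The swap hypothesis is the conclusion of
`swap_of_move` (`…HurwitzMoveSwap.lean`), so in the tree
`stub_M2geo := m2geo_of_swap' (swap_of_move <node_N1_move>)`.
Registered: `helper_getElem_off_positions` (letters off the two positions are unchanged).
Everything here is proved; no named facts, no `sorry`.  References: R. E. Gompf, A. I. Stipsicz,
*4-Manifolds and Kirby Calculus* (1999), §8.2 [GompfStipsicz1999]; A. A. Kosinski, *Differential
Manifolds* (1993), VI §6 [Kosinski1993].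
-/

noncomputable section

set_option linter.dupNamespace false

open scoped Manifold ContDiff Topology
open Set Function

namespace Summit.SmoothPoincare4.SmoothPoincare4.Theorems.AcyclicBisectionExists.ModpBraidOrbits

open Literature.GroupTheory.CombinatorialGroupTheory.SignedHurwitz
open Literature.Topology.FourManifolds Literature.Topology.FourManifolds.LefschetzBase
open Literature.Topology.FourManifolds.HandleAttachingMap
open ModelsOnFibredOfReach HurwitzMove

/-- **(M2-T) from N1-swap, corrected form.**  HYPOTHESIS `hswap` = the geometric node N1-swap of
the design (`node_N1_swap`, wave-6 form): the two handles at positions `i`, `i+1` of a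
Lefschetz-type family exchanged on fibred data, the UNTOUCHED handles reported by their pages,
shadows and twistings (their tubes may be shrunk), the two moved ones by the exchanged pages and the
classes `transvection (v i, s i) (v (i+1))`, `v i` (`up`) resp. `v (i+1)`,
`transvection (v (i+1), ¬ s (i+1)) (v i)` (`¬ up`), all twistings kept, data `D'`, `G : X ≅ X'`
and the seam clause through `G`.  CONCLUSION: the transfer form (M2-T) of one signed Hurwitz move
(unpack `l = pre ++ a :: b :: suf`, swap with `up :=` the disjunct, belt clause from V4 `belt_pos`,
re-index along `finCongr ≫ Equiv.swap` with V5's `reindexData`, letters of `l'`).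
[cite: GompfStipsicz1999, §8.2] -/
theorem transfer_of_swap'
    (hswap : 
      ∀ (g n : ℕ) (X : Type) [TopologicalSpace X] [T2Space X] [SecondCountableTopology X]
        [CompactSpace X] [ChartedSpace (EuclideanHalfSpace 4) X] [IsManifold (𝓡∂ 4) ∞ X]
        (h : Fin n → HandleAttachingMap 3 2 (Base g)) (D : MultiAttachmentData h (𝓡∂ 4) X)
        (bX : BoundaryData (𝓡∂ 4) X (𝓡 3)) (Ψ : bX.carrier ≃ₘ⟮𝓡 3, 𝓡 3⟯ (bBase g).carrier)
        (v : Fin n → (Fin g ⊕ Fin g → ℤ)) (s : Fin n → Bool),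
        (∀ (k : Fin n) θ, (h k).attachingCircle θ ∈ page g (pageDir n k)) →
        (∀ k, shadow g (h k).attachingCircle (h k).continuous_attachingCircle = v k) →
        (∀ k, pageTwisting g (h k).attachingCircle (h k).attachingFraming = if s k then -1 else 1) →
        (∀ (y : bX.carrier) (a : ↥(coresComplement h)), bX.incl y = D.jA a →
          ∃ c : ℝ, 0 < c ∧ w g ((bBase g).incl (Ψ y)).1 = (c : ℂ) * w g (a : Base g).1) →
        (∀ (y : bX.carrier) (k : Fin n) (b : ↥(beltPiece 3 2)), bX.incl y = D.jB k b →
          bX.incl y ∉ range D.jA →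
          ∃ c : ℝ, 0 < c ∧ w g ((bBase g).incl (Ψ y)).1 = (c : ℂ) * pageDir n k) →
        ∀ (i : ℕ) (hi : i + 1 < n) (up : Bool),
        ∃ (X' : Type) (_ : TopologicalSpace X') (_ : T2Space X') (_ : SecondCountableTopology X')
          (_ : CompactSpace X') (_ : ChartedSpace (EuclideanHalfSpace 4) X')
          (_ : IsManifold (𝓡∂ 4) ∞ X') (h' : Fin n → HandleAttachingMap 3 2 (Base g))
          (D' : MultiAttachmentData h' (𝓡∂ 4) X') (G : X ≃ₘ⟮𝓡∂ 4, 𝓡∂ 4⟯ X'),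
          (∀ k : Fin n, k.1 ≠ i → k.1 ≠ i + 1 → ∀ θ, (h' k).attachingCircle θ ∈ page g (pageDir n k)) ∧
          (∀ θ, (h' ⟨i + 1, hi⟩).attachingCircle θ ∈ page g (pageDir n i)) ∧
          (∀ θ, (h' ⟨i, Nat.lt_of_succ_lt hi⟩).attachingCircle θ ∈ page g (pageDir n (i + 1))) ∧
          (∀ k : Fin n, k.1 ≠ i → k.1 ≠ i + 1 →
            shadow g (h' k).attachingCircle (h' k).continuous_attachingCircle = v k) ∧
          shadow g (h' ⟨i + 1, hi⟩).attachingCircle (h' ⟨i + 1, hi⟩).continuous_attachingCircle =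
            (if up then transvection (stdSymp ℤ g) (v ⟨i, Nat.lt_of_succ_lt hi⟩, s ⟨i, Nat.lt_of_succ_lt hi⟩)
              (v ⟨i + 1, hi⟩) else v ⟨i + 1, hi⟩) ∧
          shadow g (h' ⟨i, Nat.lt_of_succ_lt hi⟩).attachingCircle
              (h' ⟨i, Nat.lt_of_succ_lt hi⟩).continuous_attachingCircle =
            (if up then v ⟨i, Nat.lt_of_succ_lt hi⟩ else
              transvection (stdSymp ℤ g) (v ⟨i + 1, hi⟩, !s ⟨i + 1, hi⟩) (v ⟨i, Nat.lt_of_succ_lt hi⟩)) ∧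
          (∀ k : Fin n, pageTwisting g (h' k).attachingCircle (h' k).attachingFraming = if s k then -1 else 1) ∧
          (∀ (y : bX.carrier) (a' : ↥(coresComplement h')), G (bX.incl y) = D'.jA a' →
            ∃ c : ℝ, 0 < c ∧ w g ((bBase g).incl (Ψ y)).1 = (c : ℂ) * w g (a' : Base g).1)) :
    ∀ (g : ℕ) (l l' : IntWord g), HurwitzStep (stdSymp ℤ g) l l' →
      ∀ (X : Type) [TopologicalSpace X] [T2Space X] [SecondCountableTopology X] [CompactSpace X]
        [ChartedSpace (EuclideanHalfSpace 4) X] [IsManifold (𝓡∂ 4) ∞ X]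
        (h : Fin l.length → HandleAttachingMap 3 2 (Base g))
        (D : MultiAttachmentData h (𝓡∂ 4) X) (bX : BoundaryData (𝓡∂ 4) X (𝓡 3))
        (Ψ : bX.carrier ≃ₘ⟮𝓡 3, 𝓡 3⟯ (bBase g).carrier),
        IsLefschetzLink g l h →
        (∀ (y : bX.carrier) (a : ↥(coresComplement h)), bX.incl y = D.jA a →
          ∃ c : ℝ, 0 < c ∧ w g ((bBase g).incl (Ψ y)).1 = (c : ℂ) * w g (a : Base g).1) →
        ∃ (X' : Type) (_ : TopologicalSpace X') (_ : T2Space X') (_ : SecondCountableTopology X')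
          (_ : CompactSpace X') (_ : ChartedSpace (EuclideanHalfSpace 4) X')
          (_ : IsManifold (𝓡∂ 4) ∞ X') (h' : Fin l'.length → HandleAttachingMap 3 2 (Base g))
          (D' : MultiAttachmentData h' (𝓡∂ 4) X') (G : X ≃ₘ⟮𝓡∂ 4, 𝓡∂ 4⟯ X'),
          IsLefschetzLink g l' h' ∧
          ∀ (y : bX.carrier) (a' : ↥(coresComplement h')), G (bX.incl y) = D'.jA a' →
            ∃ c : ℝ, 0 < c ∧ w g ((bBase g).incl (Ψ y)).1 = (c : ℂ) * w g (a' : Base g).1 := by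
  intro g l l' hst X _ _ _ _ _ _ h D bX Ψ hlink hpage
  obtain ⟨pre, suf, a, b, hl, hl'⟩ := hst
  subst hl
  -- the two positions `|pre|`, `|pre| + 1`
  have hiB : pre.length + 1 < (pre ++ a :: b :: suf).length := by simp
  have hiA : pre.length < (pre ++ a :: b :: suf).length := Nat.lt_of_succ_lt hiB
  have ha : (pre ++ a :: b :: suf).get ⟨pre.length, hiA⟩ = a := getElem_mid_fst pre suf a b hiA
  have hb : (pre ++ a :: b :: suf).get ⟨pre.length + 1, hiB⟩ = b := getElem_mid_snd pre suf a b hiB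
  -- the belt clause (V4) and the swap
  have hbelt : ∀ (y : bX.carrier) (k : Fin (pre ++ a :: b :: suf).length) (b' : ↥(beltPiece 3 2)),
      bX.incl y = D.jB k b' → bX.incl y ∉ range D.jA →
      ∃ c : ℝ, 0 < c ∧ w g ((bBase g).incl (Ψ y)).1 = (c : ℂ) * pageDir (pre ++ a :: b :: suf).length k :=
    fun y k b' hy hdeep => BeltPageClause.belt_pos D bX Ψ.continuous Ψ.toHomeomorph.isOpenMap
      (hlink.mem_page k) hpage hy hdeep
  have key := fun up : Bool => hswap g (pre ++ a :: b :: suf).length X h D bX Ψ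
    (fun k => ((pre ++ a :: b :: suf).get k).1) (fun k => ((pre ++ a :: b :: suf).get k).2)
    hlink.mem_page hlink.shadow_eq hlink.twisting_eq hpage hbelt pre.length hiB up
  -- the new word, with its disjunct
  have main : ∀ (up : Bool) (x y : (Fin g ⊕ Fin g → ℤ) × Bool),
      x.1 = (if up then transvection (stdSymp ℤ g) (a.1, a.2) b.1 else b.1) →
      y.1 = (if up then a.1 else transvection (stdSymp ℤ g) (b.1, !b.2) a.1) →
      x.2 = b.2 → y.2 = a.2 →
      ∃ (X' : Type) (_ : TopologicalSpace X') (_ : T2Space X') (_ : SecondCountableTopology X')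
        (_ : CompactSpace X') (_ : ChartedSpace (EuclideanHalfSpace 4) X')
        (_ : IsManifold (𝓡∂ 4) ∞ X')
        (h' : Fin (pre ++ x :: y :: suf).length → HandleAttachingMap 3 2 (Base g))
        (D' : MultiAttachmentData h' (𝓡∂ 4) X') (G : X ≃ₘ⟮𝓡∂ 4, 𝓡∂ 4⟯ X'),
        IsLefschetzLink g (pre ++ x :: y :: suf) h' ∧
        ∀ (yy : bX.carrier) (a' : ↥(coresComplement h')), G (bX.incl yy) = D'.jA a' →
          ∃ c : ℝ, 0 < c ∧ w g ((bBase g).incl (Ψ yy)).1 = (c : ℂ) * w g (a' : Base g).1 := by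
    intro up x y hx1 hy1 hx2 hy2
    obtain ⟨X', _, _, _, _, _, _, h', D', G, hpO, hpB, hpA, hshO, hshB, hshA, htw', hseam'⟩ :=
      key up
    have hlen : (pre ++ x :: y :: suf).length = (pre ++ a :: b :: suf).length := by simp
    -- re-indexing: length identity then the transposition of the two positions
    obtain ⟨e, he⟩ : ∃ e : Fin (pre ++ x :: y :: suf).length ≃ Fin (pre ++ a :: b :: suf).length,
        e = (finCongr hlen).trans (Equiv.swap ⟨pre.length, hiA⟩ ⟨pre.length + 1, hiB⟩) := ⟨_, rfl⟩
    have heA : ∀ j : Fin (pre ++ x :: y :: suf).length, j.1 = pre.length →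
        e j = ⟨pre.length + 1, hiB⟩ := by
      intro j hj
      have : finCongr hlen j = ⟨pre.length, hiA⟩ := Fin.ext hj
      rw [he, Equiv.trans_apply, this, Equiv.swap_apply_left]
    have heB : ∀ j : Fin (pre ++ x :: y :: suf).length, j.1 = pre.length + 1 →
        e j = ⟨pre.length, hiA⟩ := by
      intro j hj
      have : finCongr hlen j = ⟨pre.length + 1, hiB⟩ := Fin.ext hj
      rw [he, Equiv.trans_apply, this, Equiv.swap_apply_right]
    have heO : ∀ j : Fin (pre ++ x :: y :: suf).length, j.1 ≠ pre.length → j.1 ≠ pre.length + 1 →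
        e j = ⟨j.1, hlen ▸ j.2⟩ := by
      intro j h1 h2
      have h1' : finCongr hlen j ≠ ⟨pre.length, hiA⟩ := fun c => h1 (congrArg Fin.val c)
      have h2' : finCongr hlen j ≠ ⟨pre.length + 1, hiB⟩ := fun c => h2 (congrArg Fin.val c)
      rw [he, Equiv.trans_apply, Equiv.swap_apply_of_ne_of_ne h1' h2']
      rfl
    -- the entries of the two words
    have hxj : ∀ j : Fin (pre ++ x :: y :: suf).length, j.1 = pre.length →
        (pre ++ x :: y :: suf).get j = x := by
      intro j hj
      rw [List.get_eq_getElem]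
      simp only [hj]
      exact getElem_mid_fst pre suf x y (hj ▸ j.2)
    have hyj : ∀ j : Fin (pre ++ x :: y :: suf).length, j.1 = pre.length + 1 →
        (pre ++ x :: y :: suf).get j = y := by
      intro j hj
      rw [List.get_eq_getElem]
      simp only [hj]
      exact getElem_mid_snd pre suf x y (hj ▸ j.2)
    have hoj : ∀ j : Fin (pre ++ x :: y :: suf).length, j.1 ≠ pre.length → j.1 ≠ pre.length + 1 →
        (pre ++ x :: y :: suf).get j = (pre ++ a :: b :: suf).get ⟨j.1, hlen ▸ j.2⟩ := by
      intro j h1 h2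
      rw [List.get_eq_getElem, List.get_eq_getElem]
      rcases Nat.lt_or_ge j.1 pre.length with hlt | hge
      · exact getElem_mid_left pre suf x y a b hlt _ _
      · exact getElem_mid_right pre suf x y a b (by omega) _ _
    have hfam : ∀ j, (h' ∘ ⇑e) j = h' (e j) := fun _ => rfl
    refine ⟨X', ‹_›, ‹_›, ‹_›, ‹_›, ‹_›, ‹_›, h' ∘ e, D'.reindexData e hfam, G, ⟨?_, ?_, ?_, ?_⟩, ?_⟩
    · exact (D'.reindexData e hfam).disjoint
    · -- pages
      intro j θ
      have hdir : pageDir (pre ++ x :: y :: suf).length j.1 = pageDir (pre ++ a :: b :: suf).length j.1 :=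
        congrArg (fun m => pageDir m j.1) hlen
      rw [hdir, Function.comp_apply]
      by_cases h1 : j.1 = pre.length
      · rw [heA j h1, h1]; exact hpB θ
      by_cases h2 : j.1 = pre.length + 1
      · rw [heB j h2, h2]; exact hpA θ
      · rw [heO j h1 h2]; exact hpO ⟨j.1, hlen ▸ j.2⟩ h1 h2 θ
    · -- shadows
      intro j
      by_cases h1 : j.1 = pre.length
      · have hj : (h' ∘ ⇑e) j = h' ⟨pre.length + 1, hiB⟩ := by rw [Function.comp_apply, heA j h1]
        rw [hj, hshB, hxj j h1, hx1, ha, hb]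
      by_cases h2 : j.1 = pre.length + 1
      · have hj : (h' ∘ ⇑e) j = h' ⟨pre.length, hiA⟩ := by rw [Function.comp_apply, heB j h2]
        rw [hj, hshA, hyj j h2, hy1, ha, hb]
      · have hj : (h' ∘ ⇑e) j = h' ⟨j.1, hlen ▸ j.2⟩ := by rw [Function.comp_apply, heO j h1 h2]
        rw [hj, hshO ⟨j.1, hlen ▸ j.2⟩ h1 h2, hoj j h1 h2]
    · -- twistings
      intro j
      by_cases h1 : j.1 = pre.length
      · have hj : (h' ∘ ⇑e) j = h' ⟨pre.length + 1, hiB⟩ := by rw [Function.comp_apply, heA j h1]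
        rw [hj, htw', hxj j h1, hx2, hb]
      by_cases h2 : j.1 = pre.length + 1
      · have hj : (h' ∘ ⇑e) j = h' ⟨pre.length, hiA⟩ := by rw [Function.comp_apply, heB j h2]
        rw [hj, htw', hyj j h2, hy2, ha]
      · have hj : (h' ∘ ⇑e) j = h' ⟨j.1, hlen ▸ j.2⟩ := by rw [Function.comp_apply, heO j h1 h2]
        rw [hj, htw', hoj j h1 h2]
    · -- the seam clause through `G` survives re-indexing (same base points)
      intro yy a' hy
      rw [MultiAttachmentData.reindexData_jA] at hy
      exact hseam' yy ⟨(a' : Base g), (mem_coresComplement_iff_of_eq_comp e hfam).1 a'.2⟩ hy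
  rcases hl' with rfl | rfl
  · have hx1 : (b.1 + (sgn a.2 * stdSymp ℤ g a.1 b.1) • a.1, b.2).1 =
        (if true then transvection (stdSymp ℤ g) (a.1, a.2) b.1 else b.1) := by
      rw [if_pos rfl, transvection_apply]
    have hy1 : a.1 = (if true then a.1 else transvection (stdSymp ℤ g) (b.1, !b.2) a.1) := by
      rw [if_pos rfl]
    exact main true (b.1 + (sgn a.2 * stdSymp ℤ g a.1 b.1) • a.1, b.2) a hx1 hy1 rfl rfl
  · have hx1 : b.1 = (if false then transvection (stdSymp ℤ g) (a.1, a.2) b.1 else b.1) := by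
      rw [if_neg Bool.false_ne_true]
    have hy1 : (a.1 - (sgn b.2 * stdSymp ℤ g b.1 a.1) • b.1, a.2).1 =
        (if false then a.1 else transvection (stdSymp ℤ g) (b.1, !b.2) a.1) := by
      rw [if_neg Bool.false_ne_true, transvection_apply, ModelsOnFibredOfReach.sgn_not, neg_mul, neg_smul,
        sub_eq_add_neg]
    exact main false b (a.1 - (sgn b.2 * stdSymp ℤ g b.1 a.1) • b.1, a.2) hx1 hy1 rfl rfl

/-- **(HS) from the corrected swap node** (`hurwitzStep_of_redecomposition`, p134969, after
`transfer_of_swap'`). [cite: GompfStipsicz1999, §8.2] -/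
theorem hs_of_swap'
    (hswap :
      ∀ (g n : ℕ) (X : Type) [TopologicalSpace X] [T2Space X] [SecondCountableTopology X]
        [CompactSpace X] [ChartedSpace (EuclideanHalfSpace 4) X] [IsManifold (𝓡∂ 4) ∞ X]
        (h : Fin n → HandleAttachingMap 3 2 (Base g)) (D : MultiAttachmentData h (𝓡∂ 4) X)
        (bX : BoundaryData (𝓡∂ 4) X (𝓡 3)) (Ψ : bX.carrier ≃ₘ⟮𝓡 3, 𝓡 3⟯ (bBase g).carrier)
        (v : Fin n → (Fin g ⊕ Fin g → ℤ)) (s : Fin n → Bool),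
        (∀ (k : Fin n) θ, (h k).attachingCircle θ ∈ page g (pageDir n k)) →
        (∀ k, shadow g (h k).attachingCircle (h k).continuous_attachingCircle = v k) →
        (∀ k, pageTwisting g (h k).attachingCircle (h k).attachingFraming = if s k then -1 else 1) →
        (∀ (y : bX.carrier) (a : ↥(coresComplement h)), bX.incl y = D.jA a →
          ∃ c : ℝ, 0 < c ∧ w g ((bBase g).incl (Ψ y)).1 = (c : ℂ) * w g (a : Base g).1) →
        (∀ (y : bX.carrier) (k : Fin n) (b : ↥(beltPiece 3 2)), bX.incl y = D.jB k b →
          bX.incl y ∉ range D.jA →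
          ∃ c : ℝ, 0 < c ∧ w g ((bBase g).incl (Ψ y)).1 = (c : ℂ) * pageDir n k) →
        ∀ (i : ℕ) (hi : i + 1 < n) (up : Bool),
        ∃ (X' : Type) (_ : TopologicalSpace X') (_ : T2Space X') (_ : SecondCountableTopology X')
          (_ : CompactSpace X') (_ : ChartedSpace (EuclideanHalfSpace 4) X')
          (_ : IsManifold (𝓡∂ 4) ∞ X') (h' : Fin n → HandleAttachingMap 3 2 (Base g))
          (D' : MultiAttachmentData h' (𝓡∂ 4) X') (G : X ≃ₘ⟮𝓡∂ 4, 𝓡∂ 4⟯ X'),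
          (∀ k : Fin n, k.1 ≠ i → k.1 ≠ i + 1 → ∀ θ, (h' k).attachingCircle θ ∈ page g (pageDir n k)) ∧
          (∀ θ, (h' ⟨i + 1, hi⟩).attachingCircle θ ∈ page g (pageDir n i)) ∧
          (∀ θ, (h' ⟨i, Nat.lt_of_succ_lt hi⟩).attachingCircle θ ∈ page g (pageDir n (i + 1))) ∧
          (∀ k : Fin n, k.1 ≠ i → k.1 ≠ i + 1 →
            shadow g (h' k).attachingCircle (h' k).continuous_attachingCircle = v k) ∧
          shadow g (h' ⟨i + 1, hi⟩).attachingCircle (h' ⟨i + 1, hi⟩).continuous_attachingCircle =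
            (if up then transvection (stdSymp ℤ g) (v ⟨i, Nat.lt_of_succ_lt hi⟩, s ⟨i, Nat.lt_of_succ_lt hi⟩)
              (v ⟨i + 1, hi⟩) else v ⟨i + 1, hi⟩) ∧
          shadow g (h' ⟨i, Nat.lt_of_succ_lt hi⟩).attachingCircle
              (h' ⟨i, Nat.lt_of_succ_lt hi⟩).continuous_attachingCircle =
            (if up then v ⟨i, Nat.lt_of_succ_lt hi⟩ else
              transvection (stdSymp ℤ g) (v ⟨i + 1, hi⟩, !s ⟨i + 1, hi⟩) (v ⟨i, Nat.lt_of_succ_lt hi⟩)) ∧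
          (∀ k : Fin n, pageTwisting g (h' k).attachingCircle (h' k).attachingFraming = if s k then -1 else 1) ∧
          (∀ (y : bX.carrier) (a' : ↥(coresComplement h')), G (bX.incl y) = D'.jA a' →
            ∃ c : ℝ, 0 < c ∧ w g ((bBase g).incl (Ψ y)).1 = (c : ℂ) * w g (a' : Base g).1)) :
    ∀ (M : Type) [TopologicalSpace M] [T2Space M] [SecondCountableTopology M]
      [ChartedSpace (EuclideanSpace ℝ (Fin 4)) M] [IsManifold (𝓡 4) ∞ M] (g : ℕ) (l l' : IntWord g),
      ModelsOnFibred M g l → HurwitzStep (stdSymp ℤ g) l l' → ModelsOnFibred M g l' :=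
  hurwitzStep_of_redecomposition (transfer_of_swap' hswap)

/-- **The letters of a signed Hurwitz move off the two positions are unchanged**, registered form
(sub-goal `helper_getElem_off_positions` of `stub_M2geo`; `getElem_mid_left/right` of
`…HurwitzMoveTransfer.lean` combined). [folklore] -/
theorem helper_getElem_off_positions : ∀ (α : Type) (pre suf : List α) (x y x' y' : α) (j : ℕ), (j < pre.length ∨ pre.length + 2 ≤ j) → ∀ (h₁ : j < (pre ++ x :: y :: suf).length) (h₂ : j < (pre ++ x' :: y' :: suf).length), (pre ++ x :: y :: suf)[j] = (pre ++ x' :: y' :: suf)[j] := by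
  intro α pre suf x y x' y' j hj h₁ h₂
  rcases hj with hj | hj
  · exact getElem_mid_left pre suf x y x' y' hj h₁ h₂
  · exact getElem_mid_right pre suf x y x' y' hj h₁ h₂

end Summit.SmoothPoincare4.SmoothPoincare4.Theorems.AcyclicBisectionExists.ModpBraidOrbits

end
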